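import Summits.CriticalPhenomena.PercolationContinuityZ3.Theorems.PercNearOneGluingNoHeavyLowerTailSahiCTCN3FiveCheck0
import Summits.CriticalPhenomena.PercolationContinuityZ3.Theorems.PercNearOneGluingNoHeavyLowerTailSahiCTCN3FiveCheck1
import Summits.CriticalPhenomena.PercolationContinuityZ3.Theorems.PercNearOneGluingNoHeavyLowerTailSahiCTCN3FiveCheck2
import Summits.CriticalPhenomena.PercolationContinuityZ3.Theorems.PercNearOneGluingNoHeavyLowerTailSahiCTCN3FiveCheck3
import Summits.CriticalPhenomena.PercolationContinuityZ3.Theorems.PercNearOneGluingNoHeavyLowerTailSahiCTCN3FiveCheck4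
import HarnessLib

/-!
# `NoHeavyLowerTail` (crux stmt-CriticalPhenomena-4575), P3 lane: **the level-3 coefficientwise threshold certificate on FIVE points** —
# `Ñ₃(K_X, K_Z) ∈ ℕ[r]` for EVERY pair of simplicial complexes on `Fin 5`

Support file (seat `prim-l12-p3`, gen 21; `--supports stmt-CriticalPhenomena-4575`; `--computational` through its imports).  Memo
`run/shared/lean/prim/prim-l12/FROM-prim-l12-p3-g21-*.md`.

**THEOREM `coeff_Ngen3_nonneg_fin5`.**  For all down-sets `K_X, K_Z ⊆ 2^{Fin 5}` containing `∅`, every coefficient of the level-3 certificate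
polynomial `Ñ₃(K_X,K_Z) = Ngen 3 K_X K_Z` (`…SahiCTCNcGen`; g9's form (A) of the `(TC)` row of the threshold certificate
`ρ₃ = μ(· | exactly three closed)`) is `≥ 0` — the conjecture (CTC) of the programme (memo g9 §1) at `k = 5`, `c = 3`, the case of the first slot
"at least two of five open" (`Th₂⁵`).  Assembly of `…SahiCTCN3FiveEnum.coeff_Ngen3_nonneg_fin5_of_checks` (normal-form reduction, coded
symmetric enumeration, soundness) with the five kernel-checked parts `checkAll3_0 … checkAll3_4`.  Nothing is asserted about the crux.
-/

namespace Summit.CriticalPhenomena.PercolationContinuityZ3.Theorems.SahiCTCForms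

open Finset MvPolynomial SahiCTCGenFun

namespace N3Five

/-- All five parts of the finite check pass. [this work] -/
theorem checkAll3_all : ∀ p < 5, checkAll3 p = true
  | 0, _ => checkAll3_0
  | 1, _ => checkAll3_1
  | 2, _ => checkAll3_2
  | 3, _ => checkAll3_3
  | 4, _ => checkAll3_4
  | _ + 5, h => absurd h (by omega)

/-- **THE LEVEL-3 COEFFICIENTWISE THRESHOLD CERTIFICATE ON FIVE POINTS.**  For all simplicial complexes (down-sets containing `∅`) `K_X, K_Z` on
`Fin 5`, every coefficient of `Ñ₃(K_X, K_Z)` is nonnegative. [this work] -/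
theorem coeff_Ngen3_nonneg_fin5 {KX KZ : Finset (Finset (Fin 5))} (hKX : IsLowerSet (KX : Set (Finset (Fin 5))))
    (hKZ : IsLowerSet (KZ : Set (Finset (Fin 5)))) (h0X : ∅ ∈ KX) (h0Z : ∅ ∈ KZ) (n : Fin 5 →₀ ℕ) : 0 ≤ (Ngen 3 KX KZ).coeff n :=
  coeff_Ngen3_nonneg_fin5_of_checks checkAll3_all hKX hKZ h0X h0Z n

/-- **Value-level corollary**: `Ñ₃(K_X,K_Z)(r) ≥ 0` at every `r ≥ 0` — the `(TC)` row of the level-3 threshold certificate holds at every odds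
vector for every pair of complexes on five points. [this work] -/
theorem eval_Ngen3_nonneg_fin5 {KX KZ : Finset (Finset (Fin 5))} (hKX : IsLowerSet (KX : Set (Finset (Fin 5))))
    (hKZ : IsLowerSet (KZ : Set (Finset (Fin 5)))) (h0X : ∅ ∈ KX) (h0Z : ∅ ∈ KZ) (r : Fin 5 → ℝ) (hr : ∀ i, 0 ≤ r i) :
    0 ≤ MvPolynomial.eval₂ (Int.castRingHom ℝ) r (Ngen 3 KX KZ) := by
  have h := eval_le_of_coeff_le (P := 0) (Q := Ngen 3 KX KZ) (fun m => by rw [coeff_zero]; exact coeff_Ngen3_nonneg_fin5 hKX hKZ h0X h0Z m) r hr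
  rwa [MvPolynomial.eval₂_zero] at h

end N3Five

end Summit.CriticalPhenomena.PercolationContinuityZ3.Theorems.SahiCTCForms
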